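import Summits.SmoothPoincare4.SmoothPoincare4.Theses.WeakReductionDescent
import Literature.Topology.FourManifolds.TrisectionsProofs
import Literature.Topology.FourManifolds.HomotopyS4CompactProofs
import Literature.Topology.FourManifolds.HomotopyS4OrientableProofs

/-!
# SmoothPoincare4 / WeakReductionDescent — support `TrisectionsExist`

Settles item stmt-SmoothPoincare4-17912 (support of route WeakReductionDescent, rev 1):
every Hausdorff second-countable `C^∞` 4-manifold `M` homotopy equivalent to `S⁴` (the Statement's
bare binders + `e : M ≃ₕ S⁴`) admits a Gay–Kirby trisection `IsGKTrisection M g k T`.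

Proof: Gay–Kirby 2016, Thm. 4 is the PROVED tree theorem
`Literature.Topology.FourManifolds.exists_isBalancedGKTrisection_holds` (`TrisectionsProofs.lean`),
which wants `M` compact, connected and smoothly oriented.  All three inputs are proved tree facts:
compactness is `compactSpace_of_homotopyEquiv_sphere_four_holds` (Hatcher Prop. 3.29 / Cor. 2.14),
connectedness is transported from `S⁴` along `e` (`pathConnectedSpace_of_homotopyEquiv`,
`pathConnectedSpace_sphere_four`), and an orientation is chosen from
`isOrientable_of_homotopyEquiv_sphere_four_holds` (Lee Thm. 15.43).  A balanced `(g, k)`-trisection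
is a `(g; k, k, k)`-trisection by definition (`IsBalancedGKTrisection.isGKTrisection`).
No named-fact hypotheses: the theorem is unconditional.
-/


namespace Summit.SmoothPoincare4.SmoothPoincare4.Theorems

open Summit.SmoothPoincare4.SmoothPoincare4.Theses.WeakReductionDescent

/-- Settles stmt-SmoothPoincare4-17912: every smooth homotopy 4-sphere (bare binders `M` with
`e : M ≃ₕ S⁴`) admits a GK-trisection.  Gay–Kirby Thm. 4
(`Literature.Topology.FourManifolds.exists_isBalancedGKTrisection_holds`) fed with `CompactSpace M`
(`compactSpace_of_homotopyEquiv_sphere_four_holds`), `ConnectedSpace M` (path-connectedness of `S⁴`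
transported along `e`) and a smooth orientation (`isOrientable_of_homotopyEquiv_sphere_four_holds`).
[cite: GayKirby2016, Thm 4] -/
theorem TrisectionsExist_proof :
    Summit.SmoothPoincare4.SmoothPoincare4.Theses.WeakReductionDescent.TrisectionsExist := by
  unfold TrisectionsExist
  intro M _ _ _ _ _ e
  haveI : CompactSpace M :=
    Literature.Topology.FourManifolds.compactSpace_of_homotopyEquiv_sphere_four_holds M e
  haveI : PathConnectedSpace (Metric.sphere (0 : EuclideanSpace ℝ (Fin 5)) 1) :=
    Literature.Topology.FourManifolds.pathConnectedSpace_sphere_four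
  haveI : PathConnectedSpace M :=
    Literature.Topology.FourManifolds.pathConnectedSpace_of_homotopyEquiv e
  obtain ⟨o⟩ :=
    Literature.Topology.FourManifolds.isOrientable_of_homotopyEquiv_sphere_four_holds M e
  obtain ⟨g, k, S, -, hT⟩ :=
    Literature.Topology.FourManifolds.exists_isBalancedGKTrisection_holds M o
  exact ⟨g, fun _ => k, S, hT.isGKTrisection⟩

end Summit.SmoothPoincare4.SmoothPoincare4.Theorems
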